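/-
rh-split cell (screw), width seat 2 on line L22 (route-RiemannHypothesis-ScrewQuarticNodes, desk
rh-idea-9), 2026-08-27.  Corollary family of the graded sparse-node door: `m`-th power nodes
`x = j^m` detect the zero-free region `Re s > 1 - 2/m`.  DETECTION theorems about `ζ`'s own screw
function; RH is not proved by this and nothing here bears on the truth of RH.
-/
import Summits.RiemannHypothesis.RiemannHypothesis.Theorems.ScrewQuarticNodesGradedDoor
import HarnessLib

/-!
# Route ScrewQuarticNodes (L22) — power-node doors: `Ψ(m·log j) ≥ -C·j^{m/2-2}` detects
# `QuasiRH(1 - 2/m)` (supports item stmt-RiemannHypothesis-22170)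

`Ψ = zetaScrew` (Suzuki2023 (1.1)).  The graded door `ScrewQuarticNodesGradedDoor.gradedSparseDoor`
turns one-sided node bounds of depth `K e^{θt}` on a node set of `t`-gap
`√(K e^{θa}/(e^{(a+2)/2}+1))` into `QuasiRiemannHypothesis (1/2 + θ)`.  The `m`-th power nodes
`t_j = m·log j` (`x = j^m`) have `t`-gap `m·log(1 + 1/j) ≤ m·e^{-t/m}`, which is admissible exactly
at the depth exponent `θ = 1/2 - 2/m` (with `K ≥ 6m²`, `powerNodesDense`).  Hence
(`powerNodeDoor`): for every integer `m ≥ 4` and `C > 0`,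

  `Ψ(m·log j) ≥ -C·j^{m/2 - 2}` for all `j ≥ 1`  ⟹  no zero of `ζ` with `1 - 2/m < Re s < 1`.

Instances: `m = 4` — `Ψ(4·log j) ≥ -C` for all `j ≥ 1` implies RH (`rh_of_quartic_nodes_ge_neg_const`;
in particular the route's residual `QuarticNodePositivity` implies RH with the density bookkeeping
discharged here in general form — the route's own support item `QuarticNodesDense` (stmt-22171,
`K = 100`) remains the by-name closer of the route's `closes`); `m = 6` — `Ψ(6·log j) ≥ -C·j` gives
`QuasiRH(2/3)`; `m = 8` — `Ψ(8·log j) ≥ -C·j²` gives `QuasiRH(3/4)`.  In `x = e^t`: one-sided bounds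
`Ψ(log x) ≥ -C·x^{1/2 - 2/m}` sampled only at the `m`-th powers exclude zeros beyond `1 - 2/m`.

RH is not proved by this; nothing here bears on the truth of RH.
-/

-- D-0017: `Summit.RiemannHypothesis.RiemannHypothesis.…` duplicates the namespace BY DESIGN (single-problem summit).
set_option linter.dupNamespace false

noncomputable section

open Real Set

namespace Summit.RiemannHypothesis.RiemannHypothesis.Theorems.ScrewQuarticNodesGradedDoor

open Literature.NumberTheory.LFunctions

/-- **Ceiling node.**  For `m ≥ 1` and real `a`, the integer `j = ⌈e^{a/m}⌉` satisfies `j ≥ 1` and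
`a ≤ m·log j ≤ a + m·e^{-a/m}` (since `j < e^{a/m} + 1` and `log(1 + u) ≤ u`). -/
theorem exists_power_node (m : ℕ) (hm : 1 ≤ m) (a : ℝ) :
    ∃ j : ℕ, 1 ≤ j ∧ a ≤ m * Real.log j ∧ m * Real.log j ≤ a + m * Real.exp (-(a / m)) := by
  have hm0 : (0 : ℝ) < m := by exact_mod_cast hm
  set y : ℝ := Real.exp (a / m) with hy
  have hypos : 0 < y := Real.exp_pos _
  have hlogy : Real.log y = a / m := by rw [hy, Real.log_exp]
  refine ⟨⌈y⌉₊, Nat.ceil_pos.2 hypos, ?_, ?_⟩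
  · -- `a = m log y ≤ m log ⌈y⌉`
    have h1 : Real.log y ≤ Real.log (⌈y⌉₊ : ℕ) := Real.log_le_log hypos (Nat.le_ceil y)
    have h2 : (m : ℝ) * Real.log y = a := by rw [hlogy]; field_simp
    nlinarith
  · -- `log ⌈y⌉ ≤ log (y + 1) ≤ log y + 1/y`
    have hjpos : (0 : ℝ) < (⌈y⌉₊ : ℕ) := by exact_mod_cast Nat.ceil_pos.2 hypos
    have h1 : Real.log (⌈y⌉₊ : ℕ) ≤ Real.log (y + 1) :=
      Real.log_le_log hjpos (Nat.ceil_lt_add_one hypos.le).le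
    have h2 : Real.log (y + 1) - Real.log y ≤ 1 / y := by
      rw [← Real.log_div (by linarith) hypos.ne']
      have := Real.log_le_sub_one_of_pos (show 0 < (y + 1) / y by positivity)
      have e : (y + 1) / y - 1 = 1 / y := by field_simp; ring
      linarith
    have h3 : 1 / y = Real.exp (-(a / m)) := by rw [hy, Real.exp_neg]; field_simp
    have h4 : (m : ℝ) * Real.log y = a := by rw [hlogy]; field_simp
    have h5 : Real.log (⌈y⌉₊ : ℕ) ≤ Real.log y + Real.exp (-(a / m)) := by linarith
    nlinarith

/-- **Density of the `m`-th power nodes at depth exponent `θ = 1/2 - 2/m`.**  For `m ≥ 1` and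
`K ≥ 6m²`, the node set `{m·log j : j ≥ 1}` meets every interval
`[a, a + √(K e^{θa}/(e^{(a+2)/2}+1))]` with `a ≥ 0`: the node gap `m·e^{-a/m}` of `exists_power_node`
is at most the Nyquist gap, because `m² e^{-2a/m} (e^{(a+2)/2} + 1) ≤ (e + 1) m² e^{(1/2 - 2/m)a}
≤ K e^{θa}`. -/
theorem powerNodesDense (m : ℕ) (hm : 1 ≤ m) {K : ℝ} (hK : 6 * (m : ℝ) ^ 2 ≤ K) :
    ∃ T₀ : ℝ, ∀ a : ℝ, T₀ ≤ a → ∃ x ∈ {x : ℝ | ∃ j : ℕ, 1 ≤ j ∧ x = m * Real.log j}, a ≤ x ∧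
      x ≤ a + Real.sqrt (K * Real.exp ((1 / 2 - 2 / m) * a) / (Real.exp ((a + 2) / 2) + 1)) := by
  have hm0 : (0 : ℝ) < m := by exact_mod_cast hm
  refine ⟨0, fun a ha => ?_⟩
  obtain ⟨j, hj, h1, h2⟩ := exists_power_node m hm a
  refine ⟨m * Real.log j, ⟨j, hj, rfl⟩, h1, h2.trans ?_⟩
  gcongr
  -- `m e^{-a/m} ≤ √(K e^{θa}/(e^{(a+2)/2}+1))`
  have hden : 0 < Real.exp ((a + 2) / 2) + 1 := by positivity
  have hu : 0 < (m : ℝ) * Real.exp (-(a / m)) := by positivity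
  rw [Real.le_sqrt' hu, le_div_iff₀ hden]
  -- rewrite everything in terms of `u = e^{-a/m}` and `v = e^{a/2}`
  set u : ℝ := Real.exp (-(a / m)) with hu_def
  set v : ℝ := Real.exp (a / 2) with hv_def
  have hu2 : Real.exp ((1 / 2 - 2 / m) * a) = v * u ^ 2 := by
    rw [hv_def, hu_def, sq, ← Real.exp_add, ← Real.exp_add]
    congr 1; ring
  have hv2 : Real.exp ((a + 2) / 2) = Real.exp 1 * v := by
    rw [hv_def, ← Real.exp_add]; congr 1; ring
  rw [hu2, hv2]
  have hv1 : 1 ≤ v := by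
    rw [hv_def]; exact Real.one_le_exp (by linarith)
  have he : Real.exp 1 < 2.7182818286 := Real.exp_one_lt_d9
  have he0 : 0 < Real.exp 1 := Real.exp_pos 1
  have hm2 : (0 : ℝ) ≤ (m : ℝ) ^ 2 := sq_nonneg _
  have hu2pos : 0 ≤ u ^ 2 := sq_nonneg _
  -- `m² (e v + 1) ≤ 6 m² v ≤ K v`
  have hv0 : 0 ≤ v := le_trans zero_le_one hv1
  have hev : Real.exp 1 * v + 1 ≤ 6 * v := by
    have := mul_le_mul_of_nonneg_right he.le hv0
    linarith
  have key : (m : ℝ) ^ 2 * (Real.exp 1 * v + 1) ≤ K * v := by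
    calc (m : ℝ) ^ 2 * (Real.exp 1 * v + 1) ≤ (m : ℝ) ^ 2 * (6 * v) := by gcongr
      _ = 6 * (m : ℝ) ^ 2 * v := by ring
      _ ≤ K * v := by gcongr
  calc ((m : ℝ) * u) ^ 2 * (Real.exp 1 * v + 1) = u ^ 2 * ((m : ℝ) ^ 2 * (Real.exp 1 * v + 1)) := by
        ring
    _ ≤ u ^ 2 * (K * v) := by gcongr
    _ = K * (v * u ^ 2) := by ring

/-- **Power-node door.**  For every integer `m ≥ 4` and `C > 0`: if `Ψ(m·log j) ≥ -C·j^{m/2 - 2}`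
for every integer `j ≥ 1` (one-sided bounds of depth `x^{1/2 - 2/m}` at the `m`-th powers
`x = j^m` only), then `ζ` has no zero with `1 - 2/m < Re s < 1` (`QuasiRiemannHypothesis (1 - 2/m)`).
Proof: `gradedSparseDoor` at `θ = 1/2 - 2/m ≥ 0` with `K = max C (6m²)` on the node set
`{m·log j}`, dense enough by `powerNodesDense`.  RH is not proved by this. -/
theorem powerNodeDoor (m : ℕ) (hm : 4 ≤ m) {C : ℝ} (hC : 0 < C)
    (hΨ : ∀ j : ℕ, 1 ≤ j →
      -(C * (j : ℝ) ^ ((m : ℝ) / 2 - 2)) ≤ zetaScrew (m * Real.log j)) :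
    QuasiRiemannHypothesis (1 - 2 / m) := by
  have hm1 : 1 ≤ m := le_trans (by norm_num) hm
  have hm0 : (0 : ℝ) < m := by exact_mod_cast hm1
  have hm4 : (4 : ℝ) ≤ m := by exact_mod_cast hm
  set θ : ℝ := 1 / 2 - 2 / m with hθ_def
  have hθ : 0 ≤ θ := by
    rw [hθ_def, sub_nonneg, div_le_iff₀ hm0]; linarith
  set K : ℝ := max C (6 * (m : ℝ) ^ 2) with hK_def
  have hKC : C ≤ K := le_max_left _ _
  have hK6 : 6 * (m : ℝ) ^ 2 ≤ K := le_max_right _ _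
  have hK : 0 < K := lt_of_lt_of_le hC hKC
  have hN := powerNodesDense m hm1 hK6
  have hΨN : ∀ x ∈ {x : ℝ | ∃ j : ℕ, 1 ≤ j ∧ x = m * Real.log j},
      -(K * Real.exp (θ * x)) ≤ zetaScrew x := by
    rintro x ⟨j, hj, rfl⟩
    have hjpos : (0 : ℝ) < j := by exact_mod_cast hj
    have hpow : (j : ℝ) ^ ((m : ℝ) / 2 - 2) = Real.exp (θ * (m * Real.log j)) := by
      rw [Real.rpow_def_of_pos hjpos, hθ_def]
      congr 1
      field_simp
    have h := hΨ j hj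
    rw [hpow] at h
    have hexp : 0 < Real.exp (θ * (m * Real.log j)) := Real.exp_pos _
    nlinarith
  have h := gradedSparseDoor hθ hK hN hΨN
  have e : (1 : ℝ) / 2 + θ = 1 - 2 / m := by rw [hθ_def]; ring
  rwa [e] at h

/-- **Quartic nodes, unconditional form (`m = 4`).**  If `Ψ(4·log j) ≥ -C` for every integer
`j ≥ 1` (some `C > 0`), the Riemann hypothesis holds: `powerNodeDoor` at `m = 4` gives
`QuasiRH(1/2)`, which is RH (`quasiRiemannHypothesis_one_half_iff_holds`).  In particular the
route's residual `QuarticNodePositivity` alone implies RH; the route's own support item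
`QuarticNodesDense` (stmt-22171, density at `K = 100` in the door's exact gap) stays the by-name
input of the route's `closes`.  RH is not proved by this. -/
theorem rh_of_quartic_nodes_ge_neg_const {C : ℝ} (hC : 0 < C)
    (hΨ : ∀ j : ℕ, 1 ≤ j → -C ≤ zetaScrew (4 * Real.log j)) : _root_.RiemannHypothesis := by
  have h4 : ∀ j : ℕ, 1 ≤ j →
      -(C * (j : ℝ) ^ (((4 : ℕ) : ℝ) / 2 - 2)) ≤ zetaScrew ((4 : ℕ) * Real.log j) := by
    intro j hj
    have : ((4 : ℕ) : ℝ) / 2 - 2 = 0 := by norm_num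
    rw [this, Real.rpow_zero, mul_one]
    exact_mod_cast hΨ j hj
  have h := powerNodeDoor 4 le_rfl hC h4
  have e : (1 : ℝ) - 2 / ((4 : ℕ) : ℝ) = 1 / 2 := by norm_num
  rw [e] at h
  exact quasiRiemannHypothesis_one_half_iff_holds.1 h

/-- **The route's residual alone implies RH** (unconditional in the density support):
`QuarticNodePositivity → RiemannHypothesis`, by `rh_of_quartic_nodes_ge_neg_const` with `C = 1`
(`Ψ(4 log j) ≥ 0 ≥ -1`).  RH is not proved by this (the residual is RH-equivalent and open). -/
theorem rh_of_quarticNodePositivity'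
    (hR : Summit.RiemannHypothesis.RiemannHypothesis.Theses.ScrewQuarticNodes.QuarticNodePositivity) :
    _root_.RiemannHypothesis :=
  rh_of_quartic_nodes_ge_neg_const one_pos fun j hj => by
    have := hR j hj
    linarith

/-- **Sextic nodes (`m = 6`).**  `Ψ(6·log j) ≥ -C·j` for all `j ≥ 1` excludes zeros of `ζ` with
`2/3 < Re s < 1`. -/
theorem quasiRH_two_thirds_of_sextic_nodes {C : ℝ} (hC : 0 < C)
    (hΨ : ∀ j : ℕ, 1 ≤ j → -(C * j) ≤ zetaScrew (6 * Real.log j)) :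
    QuasiRiemannHypothesis (2 / 3) := by
  have h6 : ∀ j : ℕ, 1 ≤ j →
      -(C * (j : ℝ) ^ (((6 : ℕ) : ℝ) / 2 - 2)) ≤ zetaScrew ((6 : ℕ) * Real.log j) := by
    intro j hj
    have : ((6 : ℕ) : ℝ) / 2 - 2 = 1 := by norm_num
    rw [this, Real.rpow_one]
    exact_mod_cast hΨ j hj
  have h := powerNodeDoor 6 (by norm_num) hC h6
  have e : (1 : ℝ) - 2 / ((6 : ℕ) : ℝ) = 2 / 3 := by norm_num
  rwa [e] at h

/-- **Octic nodes (`m = 8`).**  `Ψ(8·log j) ≥ -C·j²` for all `j ≥ 1` excludes zeros of `ζ` with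
`3/4 < Re s < 1`. -/
theorem quasiRH_three_quarters_of_octic_nodes {C : ℝ} (hC : 0 < C)
    (hΨ : ∀ j : ℕ, 1 ≤ j → -(C * (j : ℝ) ^ 2) ≤ zetaScrew (8 * Real.log j)) :
    QuasiRiemannHypothesis (3 / 4) := by
  have h8 : ∀ j : ℕ, 1 ≤ j →
      -(C * (j : ℝ) ^ (((8 : ℕ) : ℝ) / 2 - 2)) ≤ zetaScrew ((8 : ℕ) * Real.log j) := by
    intro j hj
    have : ((8 : ℕ) : ℝ) / 2 - 2 = (2 : ℕ) := by norm_num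
    rw [this, Real.rpow_natCast]
    exact_mod_cast hΨ j hj
  have h := powerNodeDoor 8 (by norm_num) hC h8
  have e : (1 : ℝ) - 2 / ((8 : ℕ) : ℝ) = 3 / 4 := by norm_num
  rwa [e] at h

/-- **The L22 residual is RH-equivalent with NO density hypothesis** (kernel bookkeeping for
stmt-RiemannHypothesis-22170, sharpening `ScrewQuarticNodes.quarticNodePositivity_iff_rh`, which
carried `QuarticNodesDense` as a hypothesis): `QuarticNodePositivity ↔ RiemannHypothesis` — `⟹` by
`rh_of_quarticNodePositivity'` (power-node door at `m = 4`), `⟸` by Suzuki2023 Thm 1.7 (`Ψ ≥ 0`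
under RH, tree `ZetaScrewThm17.zetaScrew_nonneg_of_RH`).  RH is not proved by this (the residual is
open and is nobody's proving target). -/
theorem quarticNodePositivity_iff_rh' :
    Summit.RiemannHypothesis.RiemannHypothesis.Theses.ScrewQuarticNodes.QuarticNodePositivity ↔
      _root_.RiemannHypothesis :=
  ⟨rh_of_quarticNodePositivity', fun hRH _ _ => ZetaScrewThm17.zetaScrew_nonneg_of_RH hRH _⟩

end Summit.RiemannHypothesis.RiemannHypothesis.Theorems.ScrewQuarticNodesGradedDoor

end
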